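import Summits.NavierStokesRegularity.NavierStokesRegularity.Theorems.CalmSliceGateOneSymmetricSliceDistributional
import Literature.Barriers.NavierStokesRegularity.AxisymmetricTypeIExclusionHolds
import Literature.Analysis.FluidPDE.AxisymmetricTypeIAxis
import Literature.Analysis.FluidPDE.WeakSolutionProofs
import Mathlib.MeasureTheory.Integral.MeanInequalities
import HarnessLib

/-!
# Route `CalmSliceGate`, crux `OneSymmetricSlice` (stmt-NavierStokesRegularity-24452):
# the registered stub `stub_axisymTypeIExclusionStd` — an axisymmetric window of a
# finite-dissipation Type-I ancient mild field has a regular apex (Seregin–Šverák)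

Theorems file of route `CalmSliceGate` (seat ns-lqd-p2 g4, cell ns-idea-3; `--supports` the
crux). Navier–Stokes regularity is NOT proved here; no summit is.

With the packaging of `…OneSymmetricSlicePressure` / `…OneSymmetricSliceDistributional` (a member
`w` of the stratum `𝒟_{C,K}` and its weighted Riesz pressure `q(t) = (−t)^{−1/4} Q(t+2)`,
`Q ∈ L³(ℝ × ℝ³)`, solve Navier–Stokes in `𝒟′((−2,0) × ℝ³)`), the barrier
`Literature.Barriers.NavierStokesRegularity.AxisymmetricTypeIExclusion` (Seregin–Šverák 2009,
Thm. 3.1; PROVED in the tree, `AxisymmetricTypeIExclusion_holds`) applies on the unit cylinder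
`Q = ssCylinder`:

* `lintegral_cube_ssCylinder_lt_top`, `lintegral_pressure_ssCylinder_lt_top` — `w ∈ L³(Q)` and
  `q ∈ L^{3/2}(Q)`: both are `(−t)^{−3/8} ×` (a function in `L²` of the bounded box
  `(−1,0) × B(0,2)`), namely `|U|³` with `U = (−t)^{1/8} w ∈ L⁶` and `|Q|^{3/2}` with `Q ∈ L³`;
  Cauchy–Schwarz and `∫_{−1}^0 (−t)^{−3/4} dt < ∞`;
* `stub_axisymTypeIExclusionStd` — VERBATIM the registered stub: a member of `𝒟_{C,K}` whose
  slices are axisymmetric for `t ∈ [−1, 0)` is NOT singular at the apex (the barrier gives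
  essential boundedness near the apex; a continuous field exceeding every bound on every
  backward cylinder is essentially unbounded there).
-/

noncomputable section

-- the summit and its single sub-problem share the name (CONVENTIONS §1), as in every Theorems file
set_option linter.dupNamespace false

namespace Summit.NavierStokesRegularity.NavierStokesRegularity.Theorems.OneSymmetricSlice.Birth

open MeasureTheory Set Filter Topology Metric Function TopologicalSpace
open Literature.Analysis Literature.Analysis.FluidPDE Literature.Barriers.NavierStokesRegularity
open scoped ENNReal NNReal RealInnerProductSpace

/-! ### Integrability on the Seregin–Šverák cylinder -/

/-- The unit cylinder lies in the box `(−1, 0) × B(0, 2)`. [cite: SereginSverak2009, §3] -/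
theorem ssCylinder_subset_box :
    ssCylinder ⊆ Ioo (-1 : ℝ) 0 ×ˢ ball (0 : EuclideanSpace ℝ (Fin 3)) 2 := fun _ hz =>
  ⟨(mem_ssCylinder.1 hz).1, mem_ball_zero_iff.2 (norm_lt_two_of_mem_ssCylinder hz)⟩

/-- `∫∫_{(−1,0) × B(0,2)} (−t)^{−3/4} < ∞`. [folklore] -/
theorem lintegral_weight_box_lt_top :
    ∫⁻ z in Ioo (-1 : ℝ) 0 ×ˢ ball (0 : EuclideanSpace ℝ (Fin 3)) 2,
      ENNReal.ofReal ((-z.1) ^ (-(3 / 4 : ℝ))) < ⊤ := by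
  rw [Measure.volume_eq_prod, ← Measure.prod_restrict]
  refine (lintegral_prod_le _).trans_lt ?_
  have hball : volume (ball (0 : EuclideanSpace ℝ (Fin 3)) 2) < ⊤ := measure_ball_lt_top
  -- the time weight is integrable on `(-1, 0)`
  have hwt : IntegrableOn (fun t : ℝ => (-t) ^ (-(3 / 4 : ℝ))) (Ioo (-1) 0) volume := by
    have h := (intervalIntegral.intervalIntegrable_rpow' (a := 0) (b := 1)
      (by norm_num : (-1 : ℝ) < -(3 / 4))).comp_sub_left 0
    have h' : IntervalIntegrable (fun t : ℝ => (-t) ^ (-(3 / 4 : ℝ))) volume (-1) 0 := by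
      simpa using h.symm
    rw [intervalIntegrable_iff_integrableOn_Ioo_of_le (by norm_num)] at h'
    exact h'
  calc ∫⁻ t in Ioo (-1 : ℝ) 0, ∫⁻ x in ball (0 : EuclideanSpace ℝ (Fin 3)) 2,
        ENNReal.ofReal ((-(t, x).1) ^ (-(3 / 4 : ℝ)))
      = ∫⁻ t in Ioo (-1 : ℝ) 0, ENNReal.ofReal ((-t) ^ (-(3 / 4 : ℝ))) *
          volume (ball (0 : EuclideanSpace ℝ (Fin 3)) 2) := by
        refine lintegral_congr fun t => ?_
        dsimp only
        rw [lintegral_const, Measure.restrict_apply_univ]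
    _ = (∫⁻ t in Ioo (-1 : ℝ) 0, ENNReal.ofReal ((-t) ^ (-(3 / 4 : ℝ)))) *
          volume (ball (0 : EuclideanSpace ℝ (Fin 3)) 2) := lintegral_mul_const' _ _ hball.ne
    _ < ⊤ := ENNReal.mul_lt_top hwt.lintegral_lt_top hball

/-- The shift `(t, x) ↦ (t + 2, x)` preserves Lebesgue measure on `ℝ × ℝ³` and is a measurable
embedding. [folklore] -/
theorem measurePreserving_shift :
    MeasurePreserving (fun z : ℝ × EuclideanSpace ℝ (Fin 3) => (z.1 + 2, z.2)) volume volume ∧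
      MeasurableEmbedding (fun z : ℝ × EuclideanSpace ℝ (Fin 3) => (z.1 + 2, z.2)) := by
  have e : (fun z : ℝ × EuclideanSpace ℝ (Fin 3) => (z.1 + 2, z.2)) =
      Prod.map (· + (2 : ℝ)) id := by funext z; rfl
  refine ⟨?_, ?_⟩
  · rw [e, Measure.volume_eq_prod]
    exact (measurePreserving_add_right volume (2 : ℝ)).prod (MeasurePreserving.id volume)
  · rw [e]
    exact ((Homeomorph.addRight (2 : ℝ)).prodCongr (Homeomorph.refl _)).measurableEmbedding

/-- **Cauchy–Schwarz against the weight**: for an a.e.-measurable `g` on the box,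
`∫∫_box (−t)^{−3/8} g ≤ (∫∫_box (−t)^{−3/4})^{1/2} (∫∫_box g²)^{1/2}`; in particular the left side
is finite once `∫∫_box g² < ∞`. [folklore] -/
theorem lintegral_weight_mul_lt_top {g : ℝ × EuclideanSpace ℝ (Fin 3) → ℝ≥0∞}
    (hg : AEMeasurable g (volume.restrict (Ioo (-1 : ℝ) 0 ×ˢ ball (0 : EuclideanSpace ℝ (Fin 3)) 2)))
    (hg2 : ∫⁻ z in Ioo (-1 : ℝ) 0 ×ˢ ball (0 : EuclideanSpace ℝ (Fin 3)) 2, g z ^ (2 : ℝ) < ⊤) :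
    ∫⁻ z in Ioo (-1 : ℝ) 0 ×ˢ ball (0 : EuclideanSpace ℝ (Fin 3)) 2,
        ENNReal.ofReal ((-z.1) ^ (-(3 / 8 : ℝ))) * g z < ⊤ := by
  have hf : AEMeasurable (fun z : ℝ × EuclideanSpace ℝ (Fin 3) =>
      ENNReal.ofReal ((-z.1) ^ (-(3 / 8 : ℝ))))
      (volume.restrict (Ioo (-1 : ℝ) 0 ×ˢ ball (0 : EuclideanSpace ℝ (Fin 3)) 2)) :=
    (ENNReal.measurable_ofReal.comp ((measurable_fst.neg).pow_const _)).aemeasurable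
  have hcs := ENNReal.lintegral_mul_le_Lp_mul_Lq
    (volume.restrict (Ioo (-1 : ℝ) 0 ×ˢ ball (0 : EuclideanSpace ℝ (Fin 3)) 2))
    (⟨by norm_num, by norm_num, by norm_num⟩ : Real.HolderConjugate (2 : ℝ) 2) hf hg
  refine lt_of_le_of_lt hcs (ENNReal.mul_lt_top ?_ ?_)
  · refine ENNReal.rpow_lt_top_of_nonneg (by norm_num) (ne_of_lt ?_)
    have e : ∀ z : ℝ × EuclideanSpace ℝ (Fin 3), z ∈ Ioo (-1 : ℝ) 0 ×ˢ ball (0 : EuclideanSpace ℝ (Fin 3)) 2 →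
        ENNReal.ofReal ((-z.1) ^ (-(3 / 8 : ℝ))) ^ (2 : ℝ) = ENNReal.ofReal ((-z.1) ^ (-(3 / 4 : ℝ))) := by
      intro z hz
      have hz1 : 0 < -z.1 := neg_pos.2 (mem_prod.1 hz).1.2
      rw [ENNReal.ofReal_rpow_of_nonneg (Real.rpow_nonneg hz1.le _) (by norm_num),
        ← Real.rpow_mul hz1.le]
      norm_num
    rw [setLIntegral_congr_fun (measurableSet_Ioo.prod measurableSet_ball) e]
    exact lintegral_weight_box_lt_top
  · exact ENNReal.rpow_lt_top_of_nonneg (by norm_num) hg2.ne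

/-- **`w ∈ L³` of the unit cylinder** for a member of `𝒟_{C,K}`: on the box
`|w|³ = (−t)^{−3/8} |U(t+2)|³` with the weighted field `U ∈ L⁶(ℝ × ℝ³)` of
`…OneSymmetricSlicePressure`, and Cauchy–Schwarz. [cite: SereginSverak2009, §3 (hypothesis u ∈ L³(Q))] -/
theorem lintegral_cube_ssCylinder_lt_top {C K : ℝ}
    {w : ℝ → EuclideanSpace ℝ (Fin 3) → EuclideanSpace ℝ (Fin 3)} (hw : IsTypeIAncientMild C w)
    (hD : ∀ s : ℝ, s < 0 → ∫⁻ x, ‖fderiv ℝ (w s) x‖ₑ ^ 2 ≤ ENNReal.ofReal (K / Real.sqrt (-s))) :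
    ∫⁻ z in ssCylinder, ‖w z.1 z.2‖ₑ ^ (3 : ℕ) < ∞ := by
  have hU := memLp_six_weighted hw hD
  set U : ℝ × EuclideanSpace ℝ (Fin 3) → EuclideanSpace ℝ (Fin 3) :=
    (Ioo (0 : ℝ) 2 ×ˢ (univ : Set (EuclideanSpace ℝ (Fin 3)))).indicator
      fun z => ((2 - z.1) ^ (1 / 8 : ℝ)) • w (z.1 - 2) z.2 with hUdef
  obtain ⟨hshift, hemb⟩ := measurePreserving_shift
  have hbox : MeasurableSet (Ioo (-1 : ℝ) 0 ×ˢ ball (0 : EuclideanSpace ℝ (Fin 3)) 2) :=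
    measurableSet_Ioo.prod measurableSet_ball
  -- `g = |U ∘ shift|³`
  set g : ℝ × EuclideanSpace ℝ (Fin 3) → ℝ≥0∞ := fun z => ‖U (z.1 + 2, z.2)‖ₑ ^ (3 : ℝ) with hgdef
  have hUm : AEStronglyMeasurable (fun z : ℝ × EuclideanSpace ℝ (Fin 3) => U (z.1 + 2, z.2)) volume :=
    hU.1.comp_measurePreserving hshift
  have hg : AEMeasurable g (volume.restrict (Ioo (-1 : ℝ) 0 ×ˢ ball (0 : EuclideanSpace ℝ (Fin 3)) 2)) :=
    (hUm.aemeasurable.enorm.pow_const _).restrict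
  have hg2 : ∫⁻ z in Ioo (-1 : ℝ) 0 ×ˢ ball (0 : EuclideanSpace ℝ (Fin 3)) 2, g z ^ (2 : ℝ) < ⊤ := by
    have e : ∀ z, g z ^ (2 : ℝ) = ‖U (z.1 + 2, z.2)‖ₑ ^ (6 : ℝ) := fun z => by
      rw [hgdef, ← ENNReal.rpow_mul]; norm_num
    simp_rw [e]
    refine lt_of_le_of_lt (setLIntegral_le_lintegral _ _) ?_
    rw [hshift.lintegral_comp_emb hemb (fun z => ‖U z‖ₑ ^ (6 : ℝ))]
    have := (eLpNorm_lt_top_iff_lintegral_rpow_enorm_lt_top (by norm_num) (by norm_num)).1 hU.2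
    simpa using this
  have hfin := lintegral_weight_mul_lt_top hg hg2
  -- compare the integrands on the box
  refine lt_of_le_of_lt ((lintegral_mono_set ssCylinder_subset_box).trans
    (setLIntegral_mono' hbox fun z hz => ?_)) hfin
  have hz1 : 0 < -z.1 := neg_pos.2 (mem_prod.1 hz).1.2
  have hUz : U (z.1 + 2, z.2) = ((-z.1) ^ (1 / 8 : ℝ)) • w z.1 z.2 := by
    rw [hUdef, indicator_of_mem (show ((z.1 + 2, z.2) : ℝ × EuclideanSpace ℝ (Fin 3)) ∈
      Ioo (0 : ℝ) 2 ×ˢ univ from ⟨⟨by linarith [(mem_prod.1 hz).1.1], by linarith⟩, mem_univ _⟩)]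
    simp only [add_sub_cancel_right, show (2 : ℝ) - (z.1 + 2) = -z.1 by ring]
  rw [hgdef]; dsimp only
  rw [hUz, enorm_smul, ENNReal.mul_rpow_of_nonneg _ _ (by norm_num),
    Real.enorm_eq_ofReal (Real.rpow_nonneg hz1.le _),
    ENNReal.ofReal_rpow_of_nonneg (Real.rpow_nonneg hz1.le _) (by norm_num), ← Real.rpow_mul hz1.le,
    ← mul_assoc, ← ENNReal.ofReal_mul (Real.rpow_nonneg hz1.le _), ← Real.rpow_add hz1,
    ← ENNReal.rpow_natCast]
  norm_num

/-- **The weighted Riesz pressure is in `L^{3/2}` of the unit cylinder**: on the box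
`|q|^{3/2} = (−t)^{−3/8} |Q(t+2)|^{3/2}` with `Q ∈ L³(ℝ × ℝ³)`, and Cauchy–Schwarz.
[cite: SereginSverak2009, §3 (hypothesis p ∈ L^{3/2}(Q))] -/
theorem lintegral_pressure_ssCylinder_lt_top {Q : ℝ × EuclideanSpace ℝ (Fin 3) → ℝ}
    (hQ : MemLp Q 3 volume) :
    ∫⁻ z in ssCylinder, ‖(-z.1) ^ (-(1 / 4 : ℝ)) * Q (z.1 + 2, z.2)‖ₑ ^ (3 / 2 : ℝ) < ∞ := by
  obtain ⟨hshift, hemb⟩ := measurePreserving_shift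
  have hbox : MeasurableSet (Ioo (-1 : ℝ) 0 ×ˢ ball (0 : EuclideanSpace ℝ (Fin 3)) 2) :=
    measurableSet_Ioo.prod measurableSet_ball
  set g : ℝ × EuclideanSpace ℝ (Fin 3) → ℝ≥0∞ := fun z => ‖Q (z.1 + 2, z.2)‖ₑ ^ (3 / 2 : ℝ)
    with hgdef
  have hQm : AEStronglyMeasurable (fun z : ℝ × EuclideanSpace ℝ (Fin 3) => Q (z.1 + 2, z.2)) volume :=
    hQ.1.comp_measurePreserving hshift
  have hg : AEMeasurable g (volume.restrict (Ioo (-1 : ℝ) 0 ×ˢ ball (0 : EuclideanSpace ℝ (Fin 3)) 2)) :=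
    (hQm.aemeasurable.enorm.pow_const _).restrict
  have hg2 : ∫⁻ z in Ioo (-1 : ℝ) 0 ×ˢ ball (0 : EuclideanSpace ℝ (Fin 3)) 2, g z ^ (2 : ℝ) < ⊤ := by
    have e : ∀ z, g z ^ (2 : ℝ) = ‖Q (z.1 + 2, z.2)‖ₑ ^ (3 : ℝ) := fun z => by
      rw [hgdef, ← ENNReal.rpow_mul]; norm_num
    simp_rw [e]
    refine lt_of_le_of_lt (setLIntegral_le_lintegral _ _) ?_
    rw [hshift.lintegral_comp_emb hemb (fun z => ‖Q z‖ₑ ^ (3 : ℝ))]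
    have := (eLpNorm_lt_top_iff_lintegral_rpow_enorm_lt_top (by norm_num) (by norm_num)).1 hQ.2
    simpa using this
  have hfin := lintegral_weight_mul_lt_top hg hg2
  refine lt_of_le_of_lt ((lintegral_mono_set ssCylinder_subset_box).trans
    (setLIntegral_mono' hbox fun z hz => ?_)) hfin
  have hz1 : 0 < -z.1 := neg_pos.2 (mem_prod.1 hz).1.2
  rw [hgdef]; dsimp only
  rw [enorm_mul, ENNReal.mul_rpow_of_nonneg _ _ (by norm_num),
    Real.enorm_eq_ofReal (Real.rpow_nonneg hz1.le _),
    ENNReal.ofReal_rpow_of_nonneg (Real.rpow_nonneg hz1.le _) (by norm_num), ← Real.rpow_mul hz1.le]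
  norm_num

/-! ### The stub -/

/-- **`stub_axisymTypeIExclusionStd`** (registered stub of `OneSymmetricSlice`, skeleton rev 2):
a member `w` of the finite-dissipation stratum `𝒟_{C,K}` whose slices are axisymmetric about
the `x₃`-axis for all `t ∈ [−1, 0)` is NOT singular at the apex. Proof: `(w, q)` with the
weighted Riesz pressure `q` is a distributional solution on the Seregin–Šverák cylinder
(`exists_pressure_back` + restriction), with `w ∈ L³(Q)`, `q ∈ L^{3/2}(Q)`, the Type-I bound a.e.
and axisymmetric slices; the barrier `AxisymmetricTypeIExclusion` (Seregin–Šverák 2009 Thm 3.1,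
PROVED in tree) makes `w` essentially bounded near the apex, which a continuous field exceeding
every bound on every backward cylinder is not. [cite: SereginSverak2009, Thm. 3.1 (= Thm. 1.1)] -/
theorem stub_axisymTypeIExclusionStd (C K : ℝ)
    (w : ℝ → EuclideanSpace ℝ (Fin 3) → EuclideanSpace ℝ (Fin 3)) (hw : IsTypeIAncientMild C w)
    (hD : ∀ s : ℝ, s < 0 → ∫⁻ x, ‖fderiv ℝ (w s) x‖ₑ ^ 2 ≤ ENNReal.ofReal (K / Real.sqrt (-s)))
    (hsym : ∀ t ∈ Set.Ico (-1 : ℝ) 0, IsAxisymmetric (w t)) :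
    ¬ (∀ r > 0, ∀ M : ℝ, ∃ t ∈ Set.Ioo (-(r ^ 2)) (0 : ℝ),
      ∃ x ∈ Metric.ball (0 : EuclideanSpace ℝ (Fin 3)) r, M < ‖w t x‖) := by
  intro hsing
  -- the distributional solution on the cylinder
  obtain ⟨Q, hQ, hsol⟩ := exists_pressure_back hw hD
  have hle : ssCylinderOpens ≤ slab (EuclideanSpace ℝ (Fin 3)) (Ioo (-2) 0) isOpen_Ioo := by
    intro z hz
    have h1 := (mem_ssCylinder.1 hz).1
    exact mem_slab.2 ⟨by linarith [h1.1], h1.2⟩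
  have hsolQ := IsDistributionalNSSolutionOn.mono_holds hsol hle
  -- the hypotheses of the barrier
  have hu3 := lintegral_cube_ssCylinder_lt_top hw hD
  have hp := lintegral_pressure_ssCylinder_lt_top hQ
  have haxi : ∀ t ∈ Ioo (-1 : ℝ) 0, IsAxisymmetric (w t) := fun t ht => hsym t ⟨ht.1.le, ht.2⟩
  have htypeI : ∃ C' : ℝ, ∀ᵐ z ∂(volume.restrict ssCylinder), Real.sqrt (-z.1) * ‖w z.1 z.2‖ ≤ C' := by
    refine ⟨C, ?_⟩
    filter_upwards [ae_restrict_mem isOpen_ssCylinder.measurableSet] with z hz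
    have hz0 : z.1 < 0 := (mem_ssCylinder.1 hz).1.2
    have hs : 0 < Real.sqrt (-z.1) := Real.sqrt_pos.2 (neg_pos.2 hz0)
    have := hw.norm_le hz0 z.2
    rw [le_div_iff₀ hs] at this
    linarith [mul_comm (Real.sqrt (-z.1)) ‖w z.1 z.2‖]
  obtain ⟨r, hr, hbdd⟩ := AxisymmetricTypeIExclusion_holds w _ hsolQ hu3 hp haxi htypeI
  -- essential boundedness near the apex versus the singular clause
  set μr : Measure (ℝ × EuclideanSpace ℝ (Fin 3)) :=
    volume.restrict (parabolicCylinder r ((0 : ℝ), (0 : EuclideanSpace ℝ (Fin 3)))) with hμr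
  set B : ℝ≥0∞ := eLpNormEssSup (uncurry w) μr with hB
  have hBtop : B < ⊤ := by rwa [hB, ← eLpNorm_exponent_top]
  set M : ℝ := B.toReal with hM
  have hae : ∀ᵐ z ∂μr, ‖uncurry w z‖ ≤ M := by
    filter_upwards [ae_le_eLpNormEssSup (μ := μr) (f := uncurry w)] with z hz
    rw [hM, ← ENNReal.ofReal_le_iff_le_toReal hBtop.ne, ofReal_norm]
    exact hz
  obtain ⟨t, ht, x, hx, hbig⟩ := hsing r hr (M + 1)
  -- an open neighbourhood of `(t, x)` inside the cylinder where `‖w‖ > M + 1/2`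
  set V : Set (ℝ × EuclideanSpace ℝ (Fin 3)) :=
    parabolicCylinder r ((0 : ℝ), (0 : EuclideanSpace ℝ (Fin 3))) ∩
      ((Iio (0 : ℝ) ×ˢ (univ : Set (EuclideanSpace ℝ (Fin 3)))) ∩
        uncurry w ⁻¹' {v | M + 1 / 2 < ‖v‖}) with hV
  have hVopen : IsOpen V :=
    (isOpen_parabolicCylinder _ _).inter (hw.continuousOn_uncurry.isOpen_inter_preimage
      (isOpen_Iio.prod isOpen_univ) (isOpen_lt continuous_const continuous_norm))
  have hmem : ((t, x) : ℝ × EuclideanSpace ℝ (Fin 3)) ∈ V := by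
    refine ⟨?_, ⟨mem_Iio.2 ht.2, mem_univ _⟩, ?_⟩
    · show ((t, x) : ℝ × EuclideanSpace ℝ (Fin 3)) ∈
        Ioo ((0 : ℝ) - r ^ 2) 0 ×ˢ ball (0 : EuclideanSpace ℝ (Fin 3)) r
      exact ⟨⟨by linarith [ht.1], ht.2⟩, hx⟩
    · show M + 1 / 2 < ‖uncurry w (t, x)‖
      simp only [uncurry_apply_pair]; linarith
  have hVpos : 0 < volume V := hVopen.measure_pos volume ⟨_, hmem⟩
  have hVsub : V ⊆ parabolicCylinder r ((0 : ℝ), (0 : EuclideanSpace ℝ (Fin 3))) :=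
    inter_subset_left
  have hμV : μr V = volume V := by
    rw [hμr, Measure.restrict_apply hVopen.measurableSet, inter_eq_left.2 hVsub]
  -- but `‖w‖ ≤ M` a.e. on the cylinder
  have hzero : μr V = 0 := by
    refine measure_mono_null (fun z hz => ?_) (ae_iff.1 hae)
    have h2 : M + 1 / 2 < ‖uncurry w z‖ := hz.2.2
    show ¬ (‖uncurry w z‖ ≤ M)
    linarith
  rw [hμV] at hzero
  exact hVpos.ne' hzero

end Summit.NavierStokesRegularity.NavierStokesRegularity.Theorems.OneSymmetricSlice.Birth

end
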